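import Literature.MathematicalPhysics.QuantumFieldTheory.Borinsky2020.SecondSymanzikPermutahedron
import Literature.MathematicalPhysics.QuantumFieldTheory.Borinsky2020.TropicalNormalizationHeppBound
import Literature.MathematicalPhysics.QuantumFieldTheory.Borinsky2020.GeneralizedPermutahedronDimension
import HarnessLib

/-!
# §7.2 "Tropical Monte Carlo quadrature of Euclidean Feynman integrals" with the `Φ_G`-factor (Borinsky 2020): `Ψ_G`, `Φ_G` homogeneous of degrees `ℓ(G)`, `ℓ(G)+1`; "only positive coefficients … completely non-vanishing"; `𝒜`, `ℬ` for `ω(G) < 0`; the tropical normalisation `I^tr_G = J_{r_G}(G)` for `ω(G) ≥ 0` and `ω(G) ≤ 0`; and "the parametric integral is convergent if `r_G(γ) > 0`" (Theorem 27 applied; R1 as hypothesis in Part F, DERIVED from `r_G > 0` in Part G, both signs of `ω(G)`) — PROVED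

independent recomputation; certified where stated, statistical where stated; no new-physics claim.

CITATION HEADER (venture `QEDPrecision`, cell `pub-qed`, track TROPICAL, LIT seat `pub-qed-trop-lit` gen 30; VALUE-FREE: statements
about the Euclidean parametric Feynman integrand of an arbitrary connected edge list with generic kinematic data — no integral is
evaluated numerically, nothing per word, nothing of any Set V family). Sequel to `SecondSymanzikPermutahedron.lean` (same gen), which
put `NP_{Φ_G} = 𝒢_{z_Φ}` in the tree and assembled §7.2's `𝒜`, `ℬ`, `r_G` for `ω(G) ≥ 0`: this file instantiates the companions'
Proposition 29 (`GeneralizedPermutahedronSampling.integral_tropical_eq_sectorTable_of_gp`) and Theorem 3 / 27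
(`ConvergenceTheorem.integrable_of_gp`) for the Feynman integrand (7.1) WITH its `(Ψ_G/Φ_G)^{ω(G)}` factor — the `ω(G) = 0`, `Φ`-free
case being `TropicalNormalizationHeppBound.lean`.

SOURCES, VERBATIM. [Borinsky2020] M. Borinsky, "Tropical Monte Carlo quadrature for Feynman integrals", Ann. Inst. Henri Poincaré D
10 (2023) 635–685 = arXiv:2008.12310v2 (HOME `data/lit/sources/.cache/2008.12310/tropical.tex`; e-print counter; journal §7 =
§7), §7 eq. (parametric) (l.1174–1176): "I_G = ∫_{ℙ^{E−1}_{>0}} (Π_e x_e^{ν_e} / Ψ_G(x)^{D/2}) (Ψ_G(x)/Φ_G(x))^{ω(G)} Ω … The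
superficial degree of divergence ω(G) is given by ω(G) = Σ_e ν_e − ℓ(G) D/2 … The Kirchhoff-Symanzik polynomials Ψ_G and Φ_G are
homogeneous of degree ℓ(G) and ℓ(G)+1 in the x_e variables."; §7.2 (l.1235–1243): "Because we assume that the edge weights ν_e,
the dimension D and the superficial degree of divergence ω(G) are real, we have 𝒜 = Σ_e ν_e NP_{p_e} + ω(G) NP_{Ψ_G}, ℬ = ½ D
NP_{Ψ_G} + ω(G) NP_{Φ_G} if ω(G) ≥ 0 and 𝒜 = Σ_e ν_e NP_{p_e} + (−ω(G)) NP_{Φ_G}, ℬ = ½ D NP_{Ψ_G} + (−ω(G)) NP_{Ψ_G} if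
ω(G) < 0. we can define the boolean function r_G : 2^{[E]} → ℝ as in Theorem 27, r_G(γ) = z_𝒜(γ) − z_ℬ(γ) = … = Σ_{e∈γ} ν_e −
(D/2) ℓ(γ) − ω(G) δ_{m.m.}(γ) for all non-empty γ ⊂ G"; "For Euclidean kinematics, the polynomials Ψ_G and Φ_G have only positive
coefficients. Therefore, they are completely non-vanishing on ℙ^{E−1}_{>0}. We can apply Theorem 27 independently of the sign of
ω(G) and find that the parametric integral in eq. (parametric) is convergent if r_G(γ) > 0 for all non-empty proper γ ⊊ G by
using Corollary 24 which implies 𝒜 ⊂ relint ℬ in this case."; (l.1245–1252): "the tropical differential form associated to I_G is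
μ^tr_G = (1/I^tr_G) (Π_e x_e^{ν_e}/Ψ^tr_G(x)^{D/2}) (Ψ^tr_G(x)/Φ^tr_G(x))^{ω(G)} Ω, with an appropriate normalization factor
I^tr_G such that 1 = ∫ μ^tr_G … By Definition 28, the normalization factor can be generalized to a subgraph function J_G : 2^{[E]}
→ ℝ which is determined by the recursion J_G(γ) = Σ_{e∈γ} J_G(γ∖e)/r_G(γ∖e) for all non-empty γ ⊂ G with J_G(∅) = 1 and r_G(∅)
= 1. The actual normalization factor is recovered for γ = G, i.e. I_G^tr = J_G(G) by Proposition 29. With a precalculated table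
of the values r_G(γ) and J_G(γ) for all γ ⊂ G, Algorithm 4 provides an efficient way to sample from the distribution given by the
differential form μ^tr_G"; Definition 2 (l.309–311, "completely non-vanishing"), Theorem 3 with requirements R1–R3 and Theorem 27
(l.1063–1072) as typed in `TropicalApproximation.lean` / `ConvergenceTheorem.lean` / `GeneralizedPermutahedronSampling.lean`.
[Brown2017] F. Brown, Commun. Number Theory Phys. 11 (2017) 453 = arXiv:1512.06409 (corpus chunks p0007–p0008), §1.2 eq.
(degreesofPsiandPhi): "Ψ_G and Φ_G are homogeneous … deg Ψ_G = h_G, deg Φ_G(q) = h_G + 1", eq. (Edgecomplementnumber): "N_G − N_T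
= h_G + κ_T − κ_G", Def. 1.4: "Ξ_G is homogeneous in the α_e of degree h_G+1". [BorinskyMunchTellander2023] CPC 292 (2023) 108874 =
arXiv:2302.08955v2 (main.tex), §3.2 eq. (mutr) (l.644–654): "μ^tr = (1/I^tr) Π_e x_e^{ν_e} / (𝒰^tr(x)^{D_0/2} 𝒱^tr(x)^{ω_0}) Ω,
where I^tr is a normalization factor".

TYPING (no new definition; everything is the companions' vocabulary: `kirchhoffPolynomial`, `secondSymanzikPolynomial`,
`IsMassMomentumSpanning`, `IsGenericMomenta`, `zSecondSymanzik`, `graphSdc E D ν γ = Σ_{e∈γ} ν_e − (D/2) ℓ(γ)` (Panzer's `ω(γ)`;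
`graphSdc E D ν univ = ω(G)`), `trop`, `CompletelyNonVanishing`, `sectorTable` (= `J_r`), `gpPolytope`, the chart `x_n = 1`, `x =
e^{(y,0)}` of `ConvergenceTheorem.lean`; `NP⟦p⟧` the companions' local notation). `ω(G)` enters as a real parameter `ω` with the
hypothesis `graphSdc E D ν univ = ω` (resp. `= −c`), exactly the printed `ω(G) = Σ_e ν_e − ℓ(G) D/2`; `δ_{m.m.}` is written `if
IsMassMomentumSpanning E p m γ then 1 else 0` as in the companion.

PROVED (0 named facts, 0 definitions). Part A: `card_compl_eq_loopNumber_of_isSpanningTree`, **`isHomogeneous_kirchhoffPolynomial`**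
(`deg Ψ_G = ℓ(G)`, connected `E`), **`isHomogeneous_secondSymanzikPolynomial`** (`deg Φ_G = ℓ(G) + 1`). Part B:
`coeff_secondSymanzikPolynomial_pos_of_mem_support`, **`completelyNonVanishing_secondSymanzikPolynomial`** (R3 for `Φ_G ≠ 0` on
`ℝ^{E}_{>0}`). Part C (`ω(G) < 0`): **`scriptA_eq_gpPolytope_of_neg`** (`Σ_e ν_e NP_{p_e} + c NP_Φ = 𝒢_{z_ν + c z_Φ}`),
**`scriptB_eq_gpPolytope_of_neg`** (`½D NP_Ψ + c NP_Ψ = 𝒢_{(D/2)ℓ + cℓ}`), `scriptA_sub_scriptB_apply_of_neg` (`r_G = graphSdc + c δ_{m.m.}`,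
i.e. `− ω(G) δ_{m.m.}` with `ω(G) = −c`). Part D: **`integral_tropical_feynman_eq_sectorTable`** (`ω(G) ≥ 0`: `∫ Π_e x_e^{ν_e}
Ψ^tr^{ω}/(Ψ^tr^{D/2} Φ^tr^{ω}) dy = J_{r_G}([n+1])`, `r_G(γ) = graphSdc E D ν γ − ω δ_{m.m.}(γ)`, `r_G(∅) = 1`),
**`integral_tropical_feynman_eq_sectorTable_of_neg`** (`ω(G) = −c ≤ 0`). Part F: **`integrable_feynman_of_R1`** (the Euclidean
integrand (7.1) is absolutely integrable over the chart when `r_G > 0` on the non-empty proper edge sets, `ω(G) ≥ 0`, under R1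
for `ℬ`). Part G (appended, same gen, on the companion `GeneralizedPermutahedronDimension.lean` = Schultka 2018 Prop. 2.47 after
Fujishige: `𝒢_z` irreducible ⇔ `dim 𝒢_z = |E| − 1`): **`Borinsky2020.integrable_of_gp_of_supermodular`** (Theorem 27's convergence
clause for supermodular `z_𝒜`, `z_ℬ` WITHOUT a separate R1 hypothesis — the rate condition forces `z_ℬ` to have no separator),
**`finrank_vectorSpan_scriptB_eq`** (R1 for `ℬ = ½D NP_Ψ + ω(G) NP_Φ` from graph + kinematic data and `r_G > 0`),
**`integrable_feynman`** (§7.2's sentence AS PRINTED: convergent if `r_G(γ) > 0` on the non-empty proper `γ`, `ω(G) ≥ 0`, no R1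
hypothesis), **`integrable_feynman_of_neg`** (the `ω(G) = −c ≤ 0` twin, "independently of the sign of ω(G)").

NOT typed / does NOT say: Schultka 2018 Prop. 4.17 (`P_G` irreducible ⇔ `G` s-irreducible, via 1VI components) — Part G obtains
R1 from the rate condition instead, which is all Theorem 27 uses (Part F's `integrable_feynman_of_R1` keeps the R1-hypothesis form);
the "proper motic subgraphs suffice" refinement ([Brown 2017, Def. 3.1]); Algorithm 4's law / Proposition 31 instantiated for the
Feynman weight (the companion's `algorithm4_law_eq_tropicalMeasure` applies verbatim to the families used in Part D — not restated);
the projective / chart-free reading of `I_G` and the omitted prefactor `Γ(ω_G)/Π_e Γ(ν_e)`; exceptional kinematics (all statements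
carry `IsGenericMomenta`), Minkowski regimes (BMT23 §2.3 / Assumption 3.2's deformed `𝒱`), analytic continuation in `ν_e`, `D` (§8 item 4); anything about
any implementation, word, signed / subtracted integrand, or variance.
(Filed by the pub-qed TROPICAL literature seat `pub-qed-trop-lit` gen 30; `tropical/lit/SOURCES.md` A35; Part G: A36.)
-/

noncomputable section

open scoped Pointwise

namespace Literature.MathematicalPhysics.QuantumFieldTheory

open Finset MvPolynomial Real MeasureTheory
open Literature.MathematicalPhysics.QuantumFieldTheory.Borinsky2020

/-- The exponent vectors of `p` read in `ℝⁿ` — the same local notation as in the companions (no new definition). -/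
local notation3 (prettyPrint := false) "pts⟦" p "⟧" =>
  ((fun d : (_ →₀ ℕ) => fun k => ((d k : ℕ) : ℝ)) '' {d | d ∈ MvPolynomial.support p})

/-- The Newton polytope `NP_p = conv(supp p)` — the same local notation as in the companions (no new definition). -/
local notation3 (prettyPrint := false) "NP⟦" p "⟧" => convexHull ℝ pts⟦p⟧

variable {N V : ℕ} (E : Fin N → Fin (V + 1) × Fin (V + 1))
variable {W : Type*} [NormedAddCommGroup W]

/-! ## Part A — "Ψ_G and Φ_G are homogeneous of degree ℓ(G) and ℓ(G)+1" -/

section Homogeneous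

/-- The degree of the square-free exponent vector `Σ_{e∈S} 𝟙_e` is `|S|`. Plumbing. [folklore] -/
private theorem degree_sum_single (S : Finset (Fin N)) :
    (∑ e' ∈ S, Finsupp.single e' (1 : ℕ) : Fin N →₀ ℕ).degree = S.card := by
  rw [map_sum]
  simp [Finsupp.degree_single]

/-- For a connected edge list a co-tree has `ℓ(E) = N − V` edges. [cite: Brown2017, §1.2 eq. (Edgecomplementnumber) (N_G − N_T = h_G + κ_T − κ_G)] -/
theorem card_compl_eq_loopNumber_of_isSpanningTree (hconn : IsConnectedEdgeList E) {T : Finset (Fin N)}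
    (hT : IsSpanningTree E T) : Tᶜ.card = loopNumber E univ := by
  rw [Finset.card_compl, Fintype.card_fin, hT.1, loopNumber, Finset.card_univ, Fintype.card_fin,
    (isConnectedEdgeList_iff_edgeRank_univ E).1 hconn]

/-- **"The Kirchhoff–Symanzik polynomial Ψ_G [is] homogeneous of degree ℓ(G)"** (every co-tree has `N − V = ℓ(G)` edges;
Brown eq. (degreesofPsiandPhi): "deg Ψ_G = h_G"), for a connected edge list. [cite: Borinsky2020, §7 (tropical.tex l.1176); Brown2017, §1.2 eq. (degreesofPsiandPhi)] -/
theorem isHomogeneous_kirchhoffPolynomial (hconn : IsConnectedEdgeList E) :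
    (kirchhoffPolynomial ℝ E).IsHomogeneous (loopNumber E univ) := by
  rw [kirchhoffPolynomial_eq_sum_monomial E ℝ]
  refine IsHomogeneous.sum _ _ _ fun T hT => isHomogeneous_monomial _ ?_
  have hT' : IsSpanningTree E T := by simpa using hT
  rw [degree_sum_single, card_compl_eq_loopNumber_of_isSpanningTree E hconn hT']

open scoped Classical in
/-- **"… and Φ_G [is] homogeneous of degree ℓ(G)+1"** (a spanning 2-forest has `V − 1` edges, so `|E ∖ T₂| = ℓ(G) + 1`, and the
mass terms `X^{𝟙_{E∖T₁}} x_e` have degree `ℓ(G) + 1`; Brown eq. (degreesofPsiandPhi): "deg Φ_G(q) = h_G + 1", "Ξ_G is homogeneous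
… of degree h_G + 1"), for a connected edge list. [cite: Borinsky2020, §7 (tropical.tex l.1176); Brown2017, §1.2 eq. (degreesofPsiandPhi) and Def. 1.4] -/
theorem isHomogeneous_secondSymanzikPolynomial (hconn : IsConnectedEdgeList E) (p : Fin (V + 1) → W) (m : Fin N → ℝ) :
    (secondSymanzikPolynomial E p m).IsHomogeneous (loopNumber E univ + 1) := by
  have hVN : V ≤ N := by
    have h := edgeRank_le_card E univ
    rw [(isConnectedEdgeList_iff_edgeRank_univ E).1 hconn, Finset.card_univ, Fintype.card_fin] at h
    exact h
  rw [secondSymanzikPolynomial_eq_sum_monomial]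
  refine IsHomogeneous.add (IsHomogeneous.sum _ _ _ fun F hF => ?_)
    (IsHomogeneous.sum _ _ _ fun T hT => IsHomogeneous.sum _ _ _ fun e _ => ?_)
  · rw [smul_monomial, smul_eq_mul, mul_one]
    refine isHomogeneous_monomial _ ?_
    have hF' : F.card + 1 = V := by
      have h : IsSpanningTwoForest E F := by simpa using hF
      exact h.1
    rw [degree_sum_single, Finset.card_compl, Fintype.card_fin, loopNumber, Finset.card_univ, Fintype.card_fin,
      (isConnectedEdgeList_iff_edgeRank_univ E).1 hconn]
    omega
  · rw [smul_monomial, smul_eq_mul, mul_one]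
    refine isHomogeneous_monomial _ ?_
    have hT' : IsSpanningTree E T := by simpa using hT
    rw [map_add, degree_sum_single, Finsupp.degree_single, card_compl_eq_loopNumber_of_isSpanningTree E hconn hT']

end Homogeneous

/-! ## Part B — "For Euclidean kinematics … Φ_G ha[s] only positive coefficients. Therefore … completely non-vanishing on ℙ^{E−1}_{>0}" -/

section Positivity

variable {E}

/-- Every coefficient of `Φ_G` on its support is POSITIVE (non-negative, `coeff_secondSymanzikPolynomial_nonneg`, and non-zero): "For
Euclidean kinematics, the polynomials Ψ_G and Φ_G have only positive coefficients." [cite: Borinsky2020, §7.2 (tropical.tex l.1243)] -/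
theorem coeff_secondSymanzikPolynomial_pos_of_mem_support (p : Fin (V + 1) → W) (m : Fin N → ℝ) {d : Fin N →₀ ℕ}
    (hd : d ∈ (secondSymanzikPolynomial E p m).support) : 0 < coeff d (secondSymanzikPolynomial E p m) :=
  lt_of_le_of_ne (coeff_secondSymanzikPolynomial_nonneg p m d) (Ne.symm (mem_support_iff.1 hd))

/-- **"Therefore, they are completely non-vanishing on ℙ^{E−1}_{>0}"** — `Φ_G ≠ 0` is completely non-vanishing (Definition 2: no
truncation to a face vanishes) on the open positive orthant, by positivity of its coefficients (the companion's
`completelyNonVanishing_of_coeff_pos`; the `Ψ_G` half is `MatrixTreeTheorem.completelyNonVanishing_kirchhoffPolynomial`) — Theorem 27's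
requirement R3 for the denominator `Φ_G` of the Euclidean Feynman integrand. [cite: Borinsky2020, §7.2 (tropical.tex l.1243); Definition 2 (l.309–311); Theorem 3 / Theorem 27 (R3)] -/
theorem completelyNonVanishing_secondSymanzikPolynomial (p : Fin (V + 1) → W) (m : Fin N → ℝ)
    (hΦ : secondSymanzikPolynomial E p m ≠ 0) :
    CompletelyNonVanishing (secondSymanzikPolynomial E p m) {x | ∀ i, 0 < x i} :=
  completelyNonVanishing_of_coeff_pos _ hΦ fun _ hd => coeff_secondSymanzikPolynomial_pos_of_mem_support p m hd

end Positivity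

/-! ## Part C — §7.2 for `ω(G) < 0`: `𝒜 = Σ_e ν_e NP_{p_e} + (−ω(G)) NP_{Φ_G}`, `ℬ = ½D NP_{Ψ_G} + (−ω(G)) NP_{Ψ_G}` -/

section NegativeSdd

variable {E}

/-- **`𝒜 = Σ_e ν_e NP_{p_e} + (−ω(G)) NP_{Φ_G} = 𝒢_{z_ν + (−ω(G)) z_Φ}` "if ω(G) < 0"** (§7.2's second line), written with `c =
−ω(G) ≥ 0`, for a connected edge list with conserved generic momenta and `Φ_G ≠ 0`. [cite: Borinsky2020, §7.2 (tropical.tex l.1237); Theorem 32; Lemma 25] -/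
theorem scriptA_eq_gpPolytope_of_neg (hconn : IsConnectedEdgeList E) {p : Fin (V + 1) → W} (hcons : ∑ v, p v = 0)
    (hgen : IsGenericMomenta p) {m : Fin N → ℝ} (hΦ : secondSymanzikPolynomial E p m ≠ 0) (ν : Fin N → ℝ) {c : ℝ}
    (hc : 0 ≤ c) :
    (∑ e, ν e • NP⟦(X e : MvPolynomial (Fin N) ℝ)⟧) + c • NP⟦secondSymanzikPolynomial E p m⟧ =
      gpPolytope ((fun γ : Finset (Fin N) => ∑ e ∈ γ, ν e) + c • zSecondSymanzik E p m) := by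
  have hz0 := zSecondSymanzik_empty (not_isMassMomentumSpanning_empty_of_ne_zero hcons hΦ)
  rw [sum_smul_newtonPolytope_X_eq_gpPolytope, smul_newtonPolytope_secondSymanzikPolynomial_eq_gpPolytope hconn hcons hgen hΦ hc,
    gpPolytope_add (supermodular_sum_weights ν) (supermodular_smul (supermodular_zSecondSymanzik p m) hc) (by simp)
      (by simp [hz0])]

/-- **`ℬ = ½D NP_{Ψ_G} + (−ω(G)) NP_{Ψ_G} = 𝒢_{(D/2)ℓ + (−ω(G))ℓ}` "if ω(G) < 0"** (§7.2's second line), `c = −ω(G) ≥ 0`, `D ≥ 0`,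
connected edge list. [cite: Borinsky2020, §7.2 (tropical.tex l.1237); Theorem 32; Lemma 25] -/
theorem scriptB_eq_gpPolytope_of_neg (hconn : IsConnectedEdgeList E) {D c : ℝ} (hD : 0 ≤ D) (hc : 0 ≤ c) :
    (D / 2) • NP⟦kirchhoffPolynomial ℝ E⟧ + c • NP⟦kirchhoffPolynomial ℝ E⟧ =
      gpPolytope ((D / 2) • (fun γ : Finset (Fin N) => (loopNumber E γ : ℝ)) +
        c • fun γ : Finset (Fin N) => (loopNumber E γ : ℝ)) := by
  have hD2 : 0 ≤ D / 2 := by positivity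
  rw [smul_newtonPolytope_kirchhoffPolynomial_eq_gpPolytope E hconn hD2,
    smul_newtonPolytope_kirchhoffPolynomial_eq_gpPolytope E hconn hc,
    gpPolytope_add (supermodular_smul (supermodular_loopNumber E) hD2) (supermodular_smul (supermodular_loopNumber E) hc)
      (by simp [loopNumber_empty]) (by simp [loopNumber_empty])]

open scoped Classical in
/-- `r_G(γ) = z_𝒜(γ) − z_ℬ(γ) = Σ_{e∈γ} ν_e − (D/2) ℓ(γ) − ω(G) δ_{m.m.}(γ)` holds verbatim for `ω(G) = −c < 0` as well ("for all
non-empty γ ⊂ G" in both cases): here `z_𝒜 − z_ℬ = graphSdc E D ν γ + c δ_{m.m.}(γ)`. [cite: Borinsky2020, §7.2 (tropical.tex l.1240–1241)] -/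
theorem scriptA_sub_scriptB_apply_of_neg {p : Fin (V + 1) → W} {m : Fin N → ℝ} (D c : ℝ) (ν : Fin N → ℝ)
    (γ : Finset (Fin N)) :
    ((fun γ : Finset (Fin N) => ∑ e ∈ γ, ν e) + c • zSecondSymanzik E p m) γ -
        ((D / 2) • (fun γ : Finset (Fin N) => (loopNumber E γ : ℝ)) + c • fun γ : Finset (Fin N) => (loopNumber E γ : ℝ)) γ =
      graphSdc E D ν γ + c * (if IsMassMomentumSpanning E p m γ then 1 else 0) := by
  rw [graphSdc_eq_weights_sub_smul_loopNumber]
  simp only [Pi.add_apply, Pi.smul_apply, smul_eq_mul, zSecondSymanzik_apply]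
  ring

end NegativeSdd

/-! ## Part D — §7.2: the tropical normalisation `I^tr_G = J_{r_G}(G)` of the Euclidean Feynman integrand (7.1), `ω(G) ≥ 0` and `ω(G) ≤ 0` -/

section Normalization

open scoped Classical in
/-- **§7.2, AS PRINTED, for `ω(G) ≥ 0`: the normalisation factor `I^tr_G` of the tropical measure `μ^tr_G = (1/I^tr_G) Π_e x_e^{ν_e}
Ψ^tr(x)^{−D/2} (Ψ^tr(x)/Φ^tr(x))^{ω(G)} Ω` IS the table entry `J_G(G)` of the recursion "J_G(γ) = Σ_{e∈γ} J_G(γ∖e)/r_G(γ∖e) …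
J_G(∅) = 1 and r_G(∅) = 1", with `r_G(γ) = Σ_{e∈γ} ν_e − (D/2) ℓ(γ) − ω(G) δ_{m.m.}(γ)` ("With a precalculated table of the values
r_G(γ) and J_G(γ) for all γ ⊂ G, Algorithm 4 provides an efficient way to sample from … μ^tr_G"; "I_G^tr = J_G(G)").** Typed, as in
the companions, in the chart `x_n = 1` in logarithmic coordinates `x = e^{(y,0)}`: for a connected edge list with `n + 1` edges,
conserved generic momenta, real masses with `Φ_G ≠ 0`, indices `ν_e ≥ 0`, `D ≥ 0`, `ω = ω(G) = Σ_e ν_e − (D/2) ℓ(G) ≥ 0`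
(`graphSdc E D ν univ = ω`) and `r_G(γ) > 0` for every non-empty proper `γ` (Theorem 27's hypothesis):
`∫ (Π_e x_e^{ν_e}) Ψ^tr(x)^{ω} / (Ψ^tr(x)^{D/2} Φ^tr(x)^{ω}) dy = J_{r_G}([n+1])` (`SectorTableRecursion.sectorTable` with `r_G(∅) =
1`). Assembled from `GeneralizedPermutahedronSampling.integral_tropical_eq_sectorTable_of_gp` (Proposition 29) with the graph data
`𝒜 = Σ_e ν_e NP_{p_e} + ω NP_{Ψ_G} = 𝒢_{z_ν + ωℓ}`, `ℬ = ½D NP_{Ψ_G} + ω NP_{Φ_G} = 𝒢_{(D/2)ℓ + ω z_Φ}`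
(`SecondSymanzikPermutahedron.scriptA_eq_gpPolytope` / `scriptB_eq_gpPolytope`). [cite: Borinsky2020, §7.2 (tropical.tex l.1237–1253), eq. (parametric) (l.1174–1176), Proposition 29 (l.1112–1122); BorinskyMunchTellander2023, §3.2 eq. (mutr) (main.tex l.644–654)] -/
theorem integral_tropical_feynman_eq_sectorTable {n V : ℕ} (E : Fin (n + 1) → Fin (V + 1) × Fin (V + 1))
    (hconn : IsConnectedEdgeList E) {p : Fin (V + 1) → W} (hcons : ∑ v, p v = 0) (hgen : IsGenericMomenta p)
    {m : Fin (n + 1) → ℝ} (hΦ : secondSymanzikPolynomial E p m ≠ 0) {D : ℝ} (hD : 0 ≤ D)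
    {ν : Fin (n + 1) → ℝ} (hν : ∀ e, 0 ≤ ν e) {ω : ℝ} (hω : 0 ≤ ω) (hωG : graphSdc E D ν univ = ω)
    (hr : ∀ γ : Finset (Fin (n + 1)), γ.Nonempty → γ ≠ univ →
      0 < graphSdc E D ν γ - ω * (if IsMassMomentumSpanning E p m γ then 1 else 0)) :
    ∫ y : Fin n → ℝ,
        ((∏ e, exp (Fin.snoc (α := fun _ => ℝ) y 0 e) ^ ν e) *
            trop (kirchhoffPolynomial ℝ E) (fun k => exp (Fin.snoc (α := fun _ => ℝ) y 0 k)) ^ ω) /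
          (trop (kirchhoffPolynomial ℝ E) (fun k => exp (Fin.snoc (α := fun _ => ℝ) y 0 k)) ^ (D / 2) *
            trop (secondSymanzikPolynomial E p m) (fun k => exp (Fin.snoc (α := fun _ => ℝ) y 0 k)) ^ ω) =
      sectorTable (fun A : Finset (Fin (n + 1)) => if A = ∅ then (1 : ℝ) else
        graphSdc E D ν A - ω * (if IsMassMomentumSpanning E p m A then 1 else 0)) univ := by
  set zA : Finset (Fin (n + 1)) → ℝ := (fun γ : Finset (Fin (n + 1)) => ∑ e ∈ γ, ν e) +
    ω • fun γ : Finset (Fin (n + 1)) => (loopNumber E γ : ℝ) with hzAdef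
  set zB : Finset (Fin (n + 1)) → ℝ := (D / 2) • (fun γ : Finset (Fin (n + 1)) => (loopNumber E γ : ℝ)) +
    ω • zSecondSymanzik E p m with hzBdef
  have hD2 : 0 ≤ D / 2 := by positivity
  have h00 : ¬ IsMassMomentumSpanning E p m ∅ := not_isMassMomentumSpanning_empty_of_ne_zero hcons hΦ
  have h0A : zA ∅ = 0 := by simp [hzAdef, loopNumber_empty]
  have h0B : zB ∅ = 0 := by simp [hzBdef, loopNumber_empty, zSecondSymanzik_empty h00]
  have hr_eq : ∀ A : Finset (Fin (n + 1)),
      zA A - zB A = graphSdc E D ν A - ω * (if IsMassMomentumSpanning E p m A then 1 else 0) := fun A =>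
    scriptA_sub_scriptB_apply D ω ν A
  -- the families `a = (x_e)_e, Ψ` with weights `ν_e, ω` and `b = (Ψ, Φ)` with weights `(D/2, ω)`
  have hA : (∑ i : Option (Fin (n + 1)), (i.elim ω ν) •
      NP⟦(i.elim (kirchhoffPolynomial ℝ E) (fun e => X e) : MvPolynomial (Fin (n + 1)) ℝ)⟧) = gpPolytope zA := by
    rw [Fintype.sum_option]
    simp only [Option.elim]
    exact (add_comm _ _).trans (scriptA_eq_gpPolytope hconn ν hω)
  have hB : (∑ j : Fin 2, (![D / 2, ω] j) •
      NP⟦(![kirchhoffPolynomial ℝ E, secondSymanzikPolynomial E p m] j : MvPolynomial (Fin (n + 1)) ℝ)⟧) = gpPolytope zB := by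
    rw [Fin.sum_univ_two]
    simp only [Matrix.cons_val_zero, Matrix.cons_val_one]
    exact scriptB_eq_gpPolytope hconn hcons hgen hΦ hD hω
  have hr' : ∀ A : Finset (Fin (n + 1)), A.Nonempty → A ≠ univ → zB A < zA A := fun A hA hA' =>
    sub_pos.1 ((hr_eq A).symm ▸ hr A hA hA')
  have htop : zA univ = zB univ := by
    refine sub_eq_zero.1 ?_
    rw [hr_eq univ, hωG, if_pos (isMassMomentumSpanning_univ hconn p m)]
    ring
  have key := integral_tropical_eq_sectorTable_of_gp
    (a := fun i : Option (Fin (n + 1)) => (i.elim (kirchhoffPolynomial ℝ E) (fun e => X e) : MvPolynomial (Fin (n + 1)) ℝ))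
    (b := ![kirchhoffPolynomial ℝ E, secondSymanzikPolynomial E p m]) (ν := fun i => i.elim ω ν) (ρ := ![D / 2, ω])
    (fun i => by cases i with
      | none => exact kirchhoffPolynomial_ne_zero E ℝ hconn
      | some e => exact X_ne_zero e)
    (fun j => by fin_cases j
                 · exact kirchhoffPolynomial_ne_zero E ℝ hconn
                 · exact hΦ)
    (fun i => by cases i with
      | none => exact hω
      | some e => exact hν e)
    (fun j => by fin_cases j
                 · exact hD2
                 · exact hω)
    (supermodular_add (supermodular_sum_weights ν) (supermodular_smul (supermodular_loopNumber E) hω))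
    (supermodular_add (supermodular_smul (supermodular_loopNumber E) hD2)
      (supermodular_smul (supermodular_zSecondSymanzik p m) hω))
    h0A h0B hA hB hr' htop
  simp only [Fintype.prod_option, Option.elim, trop_X, Fin.prod_univ_two, Matrix.cons_val_zero,
    Matrix.cons_val_one] at key
  rw [show (fun A : Finset (Fin (n + 1)) => if A = ∅ then (1 : ℝ) else
      graphSdc E D ν A - ω * (if IsMassMomentumSpanning E p m A then 1 else 0)) =
      fun A => if A = ∅ then (1 : ℝ) else zA A - zB A from funext fun A => by rw [hr_eq]]
  rw [← key]
  refine integral_congr_ae (Filter.Eventually.of_forall fun y => ?_)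
  simp only
  ring

open scoped Classical in
/-- **§7.2 for `ω(G) < 0`** ("𝒜 = Σ_e ν_e NP_{p_e} + (−ω(G)) NP_{Φ_G}, ℬ = ½D NP_{Ψ_G} + (−ω(G)) NP_{Ψ_G} if ω(G) < 0"): with `c = −ω(G)
≥ 0`, `Σ_e ν_e − (D/2) ℓ(G) = −c` and `r_G(γ) = Σ_{e∈γ} ν_e − (D/2) ℓ(γ) + c δ_{m.m.}(γ) > 0` on the non-empty proper edge sets, the
tropical normalisation of `Π_e x_e^{ν_e} Φ^tr(x)^{c} / (Ψ^tr(x)^{D/2} Ψ^tr(x)^{c})` (= the tropicalised (7.1), `(Ψ/Φ)^{ω(G)} =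
(Φ/Ψ)^{c}`) in the chart `x_n = 1` is `J_{r_G}([n+1])`. [cite: Borinsky2020, §7.2 (tropical.tex l.1237–1253), Proposition 29 (l.1112–1122)] -/
theorem integral_tropical_feynman_eq_sectorTable_of_neg {n V : ℕ} (E : Fin (n + 1) → Fin (V + 1) × Fin (V + 1))
    (hconn : IsConnectedEdgeList E) {p : Fin (V + 1) → W} (hcons : ∑ v, p v = 0) (hgen : IsGenericMomenta p)
    {m : Fin (n + 1) → ℝ} (hΦ : secondSymanzikPolynomial E p m ≠ 0) {D : ℝ} (hD : 0 ≤ D)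
    {ν : Fin (n + 1) → ℝ} (hν : ∀ e, 0 ≤ ν e) {c : ℝ} (hc : 0 ≤ c) (hωG : graphSdc E D ν univ = -c)
    (hr : ∀ γ : Finset (Fin (n + 1)), γ.Nonempty → γ ≠ univ →
      0 < graphSdc E D ν γ + c * (if IsMassMomentumSpanning E p m γ then 1 else 0)) :
    ∫ y : Fin n → ℝ,
        ((∏ e, exp (Fin.snoc (α := fun _ => ℝ) y 0 e) ^ ν e) *
            trop (secondSymanzikPolynomial E p m) (fun k => exp (Fin.snoc (α := fun _ => ℝ) y 0 k)) ^ c) /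
          (trop (kirchhoffPolynomial ℝ E) (fun k => exp (Fin.snoc (α := fun _ => ℝ) y 0 k)) ^ (D / 2) *
            trop (kirchhoffPolynomial ℝ E) (fun k => exp (Fin.snoc (α := fun _ => ℝ) y 0 k)) ^ c) =
      sectorTable (fun A : Finset (Fin (n + 1)) => if A = ∅ then (1 : ℝ) else
        graphSdc E D ν A + c * (if IsMassMomentumSpanning E p m A then 1 else 0)) univ := by
  set zA : Finset (Fin (n + 1)) → ℝ := (fun γ : Finset (Fin (n + 1)) => ∑ e ∈ γ, ν e) +
    c • zSecondSymanzik E p m with hzAdef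
  set zB : Finset (Fin (n + 1)) → ℝ := (D / 2) • (fun γ : Finset (Fin (n + 1)) => (loopNumber E γ : ℝ)) +
    c • fun γ : Finset (Fin (n + 1)) => (loopNumber E γ : ℝ) with hzBdef
  have hD2 : 0 ≤ D / 2 := by positivity
  have h00 : ¬ IsMassMomentumSpanning E p m ∅ := not_isMassMomentumSpanning_empty_of_ne_zero hcons hΦ
  have h0A : zA ∅ = 0 := by simp [hzAdef, zSecondSymanzik_empty h00]
  have h0B : zB ∅ = 0 := by simp [hzBdef, loopNumber_empty]
  have hr_eq : ∀ A : Finset (Fin (n + 1)),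
      zA A - zB A = graphSdc E D ν A + c * (if IsMassMomentumSpanning E p m A then 1 else 0) := fun A =>
    scriptA_sub_scriptB_apply_of_neg D c ν A
  have hA : (∑ i : Option (Fin (n + 1)), (i.elim c ν) •
      NP⟦(i.elim (secondSymanzikPolynomial E p m) (fun e => X e) : MvPolynomial (Fin (n + 1)) ℝ)⟧) = gpPolytope zA := by
    rw [Fintype.sum_option]
    simp only [Option.elim]
    exact (add_comm _ _).trans (scriptA_eq_gpPolytope_of_neg hconn hcons hgen hΦ ν hc)
  have hB : (∑ j : Fin 2, (![D / 2, c] j) •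
      NP⟦(![kirchhoffPolynomial ℝ E, kirchhoffPolynomial ℝ E] j : MvPolynomial (Fin (n + 1)) ℝ)⟧) = gpPolytope zB := by
    rw [Fin.sum_univ_two]
    simp only [Matrix.cons_val_zero, Matrix.cons_val_one]
    exact scriptB_eq_gpPolytope_of_neg hconn hD hc
  have hr' : ∀ A : Finset (Fin (n + 1)), A.Nonempty → A ≠ univ → zB A < zA A := fun A hA hA' =>
    sub_pos.1 ((hr_eq A).symm ▸ hr A hA hA')
  have htop : zA univ = zB univ := by
    refine sub_eq_zero.1 ?_
    rw [hr_eq univ, hωG, if_pos (isMassMomentumSpanning_univ hconn p m)]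
    ring
  have key := integral_tropical_eq_sectorTable_of_gp
    (a := fun i : Option (Fin (n + 1)) =>
      (i.elim (secondSymanzikPolynomial E p m) (fun e => X e) : MvPolynomial (Fin (n + 1)) ℝ))
    (b := ![kirchhoffPolynomial ℝ E, kirchhoffPolynomial ℝ E]) (ν := fun i => i.elim c ν) (ρ := ![D / 2, c])
    (fun i => by cases i with
      | none => exact hΦ
      | some e => exact X_ne_zero e)
    (fun j => by fin_cases j <;> exact kirchhoffPolynomial_ne_zero E ℝ hconn)
    (fun i => by cases i with
      | none => exact hc
      | some e => exact hν e)
    (fun j => by fin_cases j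
                 · exact hD2
                 · exact hc)
    (supermodular_add (supermodular_sum_weights ν) (supermodular_smul (supermodular_zSecondSymanzik p m) hc))
    (supermodular_add (supermodular_smul (supermodular_loopNumber E) hD2)
      (supermodular_smul (supermodular_loopNumber E) hc))
    h0A h0B hA hB hr' htop
  simp only [Fintype.prod_option, Option.elim, trop_X, Fin.prod_univ_two, Matrix.cons_val_zero,
    Matrix.cons_val_one] at key
  rw [show (fun A : Finset (Fin (n + 1)) => if A = ∅ then (1 : ℝ) else
      graphSdc E D ν A + c * (if IsMassMomentumSpanning E p m A then 1 else 0)) =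
      fun A => if A = ∅ then (1 : ℝ) else zA A - zB A from funext fun A => by rw [hr_eq]]
  rw [← key]
  refine integral_congr_ae (Filter.Eventually.of_forall fun y => ?_)
  simp only
  ring

end Normalization

/-! ## Part F — "the parametric integral (7.1) is convergent if r_G(γ) > 0 for all non-empty proper γ" (Theorem 27 / Theorem 3 applied) -/

section Convergence

open scoped Classical in
/-- **§7.2: "We can apply Theorem 27 … and find that the parametric integral in eq. (parametric) is convergent if r_G(γ) > 0 for all
non-empty proper γ ⊊ G by using Corollary 24 which implies 𝒜 ⊂ relint ℬ"** — for `ω(G) ≥ 0`, typed through the companion's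
`ConvergenceTheorem.integrable_of_gp` (Theorem 3 with R2 from Corollary 24): for a connected edge list with `n + 1` edges, conserved
generic momenta, `Φ_G ≠ 0`, `ν_e ≥ 0`, `D ≥ 0`, `ω = ω(G) ≥ 0`, `r_G > 0` on the non-empty proper edge sets, and Theorem 3's
requirement **R1 for `ℬ = 𝒢_{(D/2)ℓ + ω z_Φ}` kept as a HYPOTHESIS** (`dim ℬ = n`; the print does not discuss it for graphs — it
holds e.g. for the graphs of Schultka's Prop. 4.17, not typed), the Euclidean Feynman integrand (7.1)
`Π_e x_e^{ν_e} Ψ_G(x)^{ω} / (Ψ_G(x)^{D/2} Φ_G(x)^{ω})` is absolutely integrable over the chart `x_n = 1`, `x = e^{(y,0)}`. R3 is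
supplied by `completelyNonVanishing_kirchhoffPolynomial` / `completelyNonVanishing_secondSymanzikPolynomial` ("only positive
coefficients"), the homogeneity hypothesis by Part A. [cite: Borinsky2020, §7.2 (tropical.tex l.1243), Theorem 27 (l.1063–1072), Theorem 3 (R1–R3), Corollary 24 (l.1024–1033)] -/
theorem integrable_feynman_of_R1 {n V : ℕ} (E : Fin (n + 1) → Fin (V + 1) × Fin (V + 1))
    (hconn : IsConnectedEdgeList E) {p : Fin (V + 1) → W} (hcons : ∑ v, p v = 0) (hgen : IsGenericMomenta p)
    {m : Fin (n + 1) → ℝ} (hΦ : secondSymanzikPolynomial E p m ≠ 0) {D : ℝ} (hD : 0 ≤ D)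
    {ν : Fin (n + 1) → ℝ} (hν : ∀ e, 0 ≤ ν e) {ω : ℝ} (hω : 0 ≤ ω) (hωG : graphSdc E D ν univ = ω)
    (hr : ∀ γ : Finset (Fin (n + 1)), γ.Nonempty → γ ≠ univ →
      0 < graphSdc E D ν γ - ω * (if IsMassMomentumSpanning E p m γ then 1 else 0))
    (hR1 : Module.finrank ℝ (vectorSpan ℝ (gpPolytope ((D / 2) • (fun γ : Finset (Fin (n + 1)) => (loopNumber E γ : ℝ)) +
      ω • zSecondSymanzik E p m))) = n) :
    Integrable (fun y : Fin n → ℝ =>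
      ((∏ e, exp (Fin.snoc (α := fun _ => ℝ) y 0 e) ^ ν e) *
          |eval (fun k => exp (Fin.snoc (α := fun _ => ℝ) y 0 k)) (kirchhoffPolynomial ℝ E)| ^ ω) /
        (|eval (fun k => exp (Fin.snoc (α := fun _ => ℝ) y 0 k)) (kirchhoffPolynomial ℝ E)| ^ (D / 2) *
          |eval (fun k => exp (Fin.snoc (α := fun _ => ℝ) y 0 k)) (secondSymanzikPolynomial E p m)| ^ ω)) := by
  set zA : Finset (Fin (n + 1)) → ℝ := (fun γ : Finset (Fin (n + 1)) => ∑ e ∈ γ, ν e) +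
    ω • fun γ : Finset (Fin (n + 1)) => (loopNumber E γ : ℝ) with hzAdef
  set zB : Finset (Fin (n + 1)) → ℝ := (D / 2) • (fun γ : Finset (Fin (n + 1)) => (loopNumber E γ : ℝ)) +
    ω • zSecondSymanzik E p m with hzBdef
  have hD2 : 0 ≤ D / 2 := by positivity
  have h00 : ¬ IsMassMomentumSpanning E p m ∅ := not_isMassMomentumSpanning_empty_of_ne_zero hcons hΦ
  have h0B : zB ∅ = 0 := by simp [hzBdef, loopNumber_empty, zSecondSymanzik_empty h00]
  have hr_eq : ∀ A : Finset (Fin (n + 1)),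
      zA A - zB A = graphSdc E D ν A - ω * (if IsMassMomentumSpanning E p m A then 1 else 0) := fun A =>
    scriptA_sub_scriptB_apply D ω ν A
  have hA : (∑ i : Option (Fin (n + 1)), (i.elim ω ν) •
      NP⟦(i.elim (kirchhoffPolynomial ℝ E) (fun e => X e) : MvPolynomial (Fin (n + 1)) ℝ)⟧) = gpPolytope zA := by
    rw [Fintype.sum_option]
    simp only [Option.elim]
    exact (add_comm _ _).trans (scriptA_eq_gpPolytope hconn ν hω)
  have hB : (∑ j : Fin 2, (![D / 2, ω] j) •
      NP⟦(![kirchhoffPolynomial ℝ E, secondSymanzikPolynomial E p m] j : MvPolynomial (Fin (n + 1)) ℝ)⟧) = gpPolytope zB := by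
    rw [Fin.sum_univ_two]
    simp only [Matrix.cons_val_zero, Matrix.cons_val_one]
    exact scriptB_eq_gpPolytope hconn hcons hgen hΦ hD hω
  have hr' : ∀ A : Finset (Fin (n + 1)), A.Nonempty → A ≠ univ → zB A < zA A := fun A hA hA' =>
    sub_pos.1 ((hr_eq A).symm ▸ hr A hA hA')
  have htop : zA univ = zB univ := by
    refine sub_eq_zero.1 ?_
    rw [hr_eq univ, hωG, if_pos (isMassMomentumSpanning_univ hconn p m)]
    ring
  have hR1' : Module.finrank ℝ (vectorSpan ℝ (∑ j : Fin 2, (![D / 2, ω] j) •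
      NP⟦(![kirchhoffPolynomial ℝ E, secondSymanzikPolynomial E p m] j : MvPolynomial (Fin (n + 1)) ℝ)⟧)) = n := by
    rw [hB]
    exact hR1
  have key := integrable_of_gp
    (fun i : Option (Fin (n + 1)) => (i.elim (kirchhoffPolynomial ℝ E) (fun e => X e) : MvPolynomial (Fin (n + 1)) ℝ))
    ![kirchhoffPolynomial ℝ E, secondSymanzikPolynomial E p m] (fun i => i.elim ω ν) ![D / 2, ω]
    (fun i => by cases i with
      | none => exact kirchhoffPolynomial_ne_zero E ℝ hconn
      | some e => exact X_ne_zero e)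
    (fun i => by cases i with
      | none => exact hω
      | some e => exact hν e)
    (fun j => by fin_cases j
                 · exact hD2
                 · exact hω)
    (db := ![loopNumber E univ, loopNumber E univ + 1])
    (fun j => by fin_cases j
                 · exact isHomogeneous_kirchhoffPolynomial E hconn
                 · exact isHomogeneous_secondSymanzikPolynomial E hconn p m)
    h0B hA hB hr' htop hR1'
    (fun j => by fin_cases j
                 · exact completelyNonVanishing_kirchhoffPolynomial E hconn
                 · exact completelyNonVanishing_secondSymanzikPolynomial p m hΦ)
  refine key.congr (Filter.Eventually.of_forall fun y => ?_)
  simp only [Fintype.prod_option, Option.elim, eval_X, Fin.prod_univ_two, Matrix.cons_val_zero, Matrix.cons_val_one,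
    abs_of_pos (exp_pos _)]
  ring

end Convergence

/-! ### Part G: requirement R1 from the rate condition — the convergence criterion exactly as printed

Borinsky's sentence "the parametric integral in eq. (parametric) is convergent if `r_G(γ) > 0` for all non-empty proper `γ ⊊ G`"
does not mention requirement R1 of Theorem 3 (`ℬ` is `(n−1)`-dimensional); Part F above kept it as the hypothesis `hR1`. By the
companion `GeneralizedPermutahedronDimension.lean` (Schultka 2018 Prop. 2.47 after Fujishige: `𝒢_z` is irreducible iff it has
dimension `|E| − 1`; `finrank_vectorSpan_gpPolytope_eq_of_rate`) the rate condition itself forces `z_ℬ = (D/2)ℓ + ω(G) z_Φ` to have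
no separator, because `z_𝒜 = z_ν + ω(G)ℓ` is supermodular with `z_𝒜(∅) = 0` and `z_𝒜(E) = z_ℬ(E)`: so R1 HOLDS and the printed
sentence is a theorem as it stands (generic Euclidean kinematics, `ω(G) ≥ 0`). -/

section ConvergenceR1

/-- **Theorem 27's convergence clause without a separate R1 hypothesis.** As `integrable_of_gp` (`ConvergenceTheorem.lean`), for
SUPERMODULAR boolean functions `z_𝒜`, `z_ℬ` with `z_𝒜(∅) = z_ℬ(∅) = 0` ("generalized permutahedra with associated boolean functions
z_𝒜, z_ℬ"): if `𝒜 = 𝒢_{z_𝒜}`, `ℬ = 𝒢_{z_ℬ}`, `r(A) = z_𝒜(A) − z_ℬ(A) > 0` on every non-empty proper `A`, `z_𝒜([n]) = z_ℬ([n])`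
and R3 holds, then the Euler–Mellin integral converges absolutely — R1 being supplied by
`finrank_vectorSpan_gpPolytope_eq_of_rate`. [cite: Borinsky2020, Theorem 27 (tropical.tex l.1063–1072), Theorem 3 R1 (l.321–324),
Corollary 24 (l.1024–1033); Schultka2018, Proposition 2.47 (toricfeynman.tex l.1301–1308)] -/
theorem Borinsky2020.integrable_of_gp_of_supermodular {n : ℕ} {ι κ : Type*} [Fintype ι] [Fintype κ]
    (a : ι → MvPolynomial (Fin (n + 1)) ℝ) (b : κ → MvPolynomial (Fin (n + 1)) ℝ) (ν : ι → ℝ) (ρ : κ → ℝ)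
    (ha : ∀ i, a i ≠ 0) (hν : ∀ i, 0 ≤ ν i) (hρ : ∀ j, 0 ≤ ρ j)
    {db : κ → ℕ} (hhb : ∀ j, (b j).IsHomogeneous (db j))
    {zA zB : Finset (Fin (n + 1)) → ℝ} (hzA : Supermodular zA) (h0A : zA ∅ = 0) (hzB : Supermodular zB) (h0B : zB ∅ = 0)
    (hA : (∑ i, ν i • NP⟦a i⟧) = gpPolytope zA) (hB : (∑ j, ρ j • NP⟦b j⟧) = gpPolytope zB)
    (hr : ∀ A : Finset (Fin (n + 1)), A.Nonempty → A ≠ univ → zB A < zA A) (htop : zA univ = zB univ)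
    (hR3 : ∀ j, CompletelyNonVanishing (b j) {x | ∀ k, 0 < x k}) :
    Integrable (fun y : Fin n → ℝ =>
      (∏ i, |eval (fun k => exp (Fin.snoc (α := fun _ => ℝ) y 0 k)) (a i)| ^ ν i) /
        ∏ j, |eval (fun k => exp (Fin.snoc (α := fun _ => ℝ) y 0 k)) (b j)| ^ ρ j) := by
  refine integrable_of_gp a b ν ρ ha hν hρ hhb h0B hA hB hr htop ?_ hR3
  rw [hB]
  exact finrank_vectorSpan_gpPolytope_eq_of_rate hzA h0A hzB h0B hr htop

open scoped Classical in
/-- **R1 for the Euclidean Feynman polytope `ℬ = ½D NP_Ψ + ω(G) NP_Φ` from graph + kinematic data**: for a connected edge list with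
conserved generic momenta, `Φ_G ≠ 0`, `D ≥ 0`, `ν_e ≥ 0`, `ω(G) = Σ_e ν_e − ℓ(G)D/2 ≥ 0` and `r_G(γ) = ω(γ) − ω(G)δ_{m.m.}(γ) > 0`
on every non-empty proper `γ`, the polytope `ℬ = 𝒢_{(D/2)ℓ + ω(G) z_Φ}` is `n`-dimensional in `ℝ^{n+1}` (requirement R1 of Theorem 3).
[cite: Borinsky2020, §7.2 (tropical.tex l.1235–1243), Theorem 3 R1 (l.321–324); Schultka2018, Proposition 2.47 (toricfeynman.tex
l.1301–1308), cf. Proposition 4.29 (l.2711–2736: "This domain is nonempty if and only if P_G has dimension |E_G| − 1")] -/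
theorem finrank_vectorSpan_scriptB_eq {n V : ℕ} (E : Fin (n + 1) → Fin (V + 1) × Fin (V + 1))
    (hconn : IsConnectedEdgeList E) {p : Fin (V + 1) → W} (hcons : ∑ v, p v = 0)
    {m : Fin (n + 1) → ℝ} (hΦ : secondSymanzikPolynomial E p m ≠ 0) {D : ℝ} (hD : 0 ≤ D)
    {ν : Fin (n + 1) → ℝ} {ω : ℝ} (hω : 0 ≤ ω) (hωG : graphSdc E D ν univ = ω)
    (hr : ∀ γ : Finset (Fin (n + 1)), γ.Nonempty → γ ≠ univ →
      0 < graphSdc E D ν γ - ω * (if IsMassMomentumSpanning E p m γ then 1 else 0)) :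
    Module.finrank ℝ (vectorSpan ℝ (gpPolytope ((D / 2) • (fun γ : Finset (Fin (n + 1)) => (loopNumber E γ : ℝ)) +
      ω • zSecondSymanzik E p m))) = n := by
  set zA : Finset (Fin (n + 1)) → ℝ := (fun γ : Finset (Fin (n + 1)) => ∑ e ∈ γ, ν e) +
    ω • fun γ : Finset (Fin (n + 1)) => (loopNumber E γ : ℝ) with hzAdef
  set zB : Finset (Fin (n + 1)) → ℝ := (D / 2) • (fun γ : Finset (Fin (n + 1)) => (loopNumber E γ : ℝ)) +
    ω • zSecondSymanzik E p m with hzBdef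
  have hD2 : 0 ≤ D / 2 := by positivity
  have h00 : ¬ IsMassMomentumSpanning E p m ∅ := not_isMassMomentumSpanning_empty_of_ne_zero hcons hΦ
  have h0B : zB ∅ = 0 := by simp [hzBdef, loopNumber_empty, zSecondSymanzik_empty h00]
  have h0A : zA ∅ = 0 := by simp [hzAdef, loopNumber_empty]
  have hzA : Supermodular zA :=
    supermodular_add (supermodular_sum_weights ν) (supermodular_smul (supermodular_loopNumber E) hω)
  have hzB : Supermodular zB :=
    supermodular_add (supermodular_smul (supermodular_loopNumber E) hD2) (supermodular_smul (supermodular_zSecondSymanzik p m) hω)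
  have hr_eq : ∀ A : Finset (Fin (n + 1)),
      zA A - zB A = graphSdc E D ν A - ω * (if IsMassMomentumSpanning E p m A then 1 else 0) := fun A =>
    scriptA_sub_scriptB_apply D ω ν A
  have hr' : ∀ A : Finset (Fin (n + 1)), A.Nonempty → A ≠ univ → zB A < zA A := fun A hA hA' =>
    sub_pos.1 ((hr_eq A).symm ▸ hr A hA hA')
  have htop : zA univ = zB univ := by
    refine sub_eq_zero.1 ?_
    rw [hr_eq univ, hωG, if_pos (isMassMomentumSpanning_univ hconn p m)]
    ring
  exact finrank_vectorSpan_gpPolytope_eq_of_rate hzA h0A hzB h0B hr' htop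

open scoped Classical in
/-- **§7.2, "the parametric integral in eq. (parametric) is convergent if `r_G(γ) > 0` for all non-empty proper `γ ⊊ G`" — AS PRINTED,
no R1 hypothesis** (generic Euclidean kinematics, `ω(G) ≥ 0`): for a connected edge list with conserved generic momenta, `Φ_G ≠ 0`,
`D ≥ 0`, `ν_e ≥ 0`, `ω(G) = Σ_e ν_e − ℓ(G)D/2 ≥ 0` and `r_G(γ) = ω(γ) − ω(G)δ_{m.m.}(γ) > 0` on every non-empty proper `γ`, the
Euclidean Feynman integrand (7.1) `Π_e x_e^{ν_e} Ψ_G^{ω}/(Ψ_G^{D/2} Φ_G^{ω})` is absolutely integrable over the chart `x_n = 1`,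
`x = e^{(y,0)}` — `integrable_feynman_of_R1` with R1 discharged by `finrank_vectorSpan_scriptB_eq`. [cite: Borinsky2020, §7.2
(tropical.tex l.1243), Theorem 27 (l.1063–1072), Theorem 3 (R1–R3), Corollary 24 (l.1024–1033); Schultka2018, Proposition 2.47] -/
theorem integrable_feynman {n V : ℕ} (E : Fin (n + 1) → Fin (V + 1) × Fin (V + 1))
    (hconn : IsConnectedEdgeList E) {p : Fin (V + 1) → W} (hcons : ∑ v, p v = 0) (hgen : IsGenericMomenta p)
    {m : Fin (n + 1) → ℝ} (hΦ : secondSymanzikPolynomial E p m ≠ 0) {D : ℝ} (hD : 0 ≤ D)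
    {ν : Fin (n + 1) → ℝ} (hν : ∀ e, 0 ≤ ν e) {ω : ℝ} (hω : 0 ≤ ω) (hωG : graphSdc E D ν univ = ω)
    (hr : ∀ γ : Finset (Fin (n + 1)), γ.Nonempty → γ ≠ univ →
      0 < graphSdc E D ν γ - ω * (if IsMassMomentumSpanning E p m γ then 1 else 0)) :
    Integrable (fun y : Fin n → ℝ =>
      ((∏ e, exp (Fin.snoc (α := fun _ => ℝ) y 0 e) ^ ν e) *
          |eval (fun k => exp (Fin.snoc (α := fun _ => ℝ) y 0 k)) (kirchhoffPolynomial ℝ E)| ^ ω) /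
        (|eval (fun k => exp (Fin.snoc (α := fun _ => ℝ) y 0 k)) (kirchhoffPolynomial ℝ E)| ^ (D / 2) *
          |eval (fun k => exp (Fin.snoc (α := fun _ => ℝ) y 0 k)) (secondSymanzikPolynomial E p m)| ^ ω)) :=
  integrable_feynman_of_R1 E hconn hcons hgen hΦ hD hν hω hωG hr (finrank_vectorSpan_scriptB_eq E hconn hcons hΦ hD hω hωG hr)

open scoped Classical in
/-- **The `ω(G) < 0` twin, as printed ("We can apply Theorem 27 independently of the sign of ω(G)")**: with `c = −ω(G) ≥ 0`,
`Σ_e ν_e − (D/2)ℓ(G) = −c` and `r_G(γ) = ω(γ) + c δ_{m.m.}(γ) > 0` on every non-empty proper `γ` (connected edge list, conserved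
generic momenta, `Φ_G ≠ 0`, `D ≥ 0`, `ν_e ≥ 0`), the integrand `Π_e x_e^{ν_e} Φ_G^{c}/(Ψ_G^{D/2} Ψ_G^{c})` (= (7.1) with
`(Ψ/Φ)^{ω(G)} = (Φ/Ψ)^{c}`) is absolutely integrable over the chart — `𝒜 = Σ_e ν_e NP_{p_e} + c NP_Φ`, `ℬ = ½D NP_Ψ + c NP_Ψ`
(Part C), R1 by `integrable_of_gp_of_supermodular`, R3 for `Ψ_G`. [cite: Borinsky2020, §7.2 (tropical.tex l.1237–1243), Theorem 27
(l.1063–1072), Corollary 24 (l.1024–1033); Schultka2018, Proposition 2.47] -/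
theorem integrable_feynman_of_neg {n V : ℕ} (E : Fin (n + 1) → Fin (V + 1) × Fin (V + 1))
    (hconn : IsConnectedEdgeList E) {p : Fin (V + 1) → W} (hcons : ∑ v, p v = 0) (hgen : IsGenericMomenta p)
    {m : Fin (n + 1) → ℝ} (hΦ : secondSymanzikPolynomial E p m ≠ 0) {D : ℝ} (hD : 0 ≤ D)
    {ν : Fin (n + 1) → ℝ} (hν : ∀ e, 0 ≤ ν e) {c : ℝ} (hc : 0 ≤ c) (hωG : graphSdc E D ν univ = -c)
    (hr : ∀ γ : Finset (Fin (n + 1)), γ.Nonempty → γ ≠ univ →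
      0 < graphSdc E D ν γ + c * (if IsMassMomentumSpanning E p m γ then 1 else 0)) :
    Integrable (fun y : Fin n → ℝ =>
      ((∏ e, exp (Fin.snoc (α := fun _ => ℝ) y 0 e) ^ ν e) *
          |eval (fun k => exp (Fin.snoc (α := fun _ => ℝ) y 0 k)) (secondSymanzikPolynomial E p m)| ^ c) /
        (|eval (fun k => exp (Fin.snoc (α := fun _ => ℝ) y 0 k)) (kirchhoffPolynomial ℝ E)| ^ (D / 2) *
          |eval (fun k => exp (Fin.snoc (α := fun _ => ℝ) y 0 k)) (kirchhoffPolynomial ℝ E)| ^ c)) := by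
  set zA : Finset (Fin (n + 1)) → ℝ := (fun γ : Finset (Fin (n + 1)) => ∑ e ∈ γ, ν e) +
    c • zSecondSymanzik E p m with hzAdef
  set zB : Finset (Fin (n + 1)) → ℝ := (D / 2) • (fun γ : Finset (Fin (n + 1)) => (loopNumber E γ : ℝ)) +
    c • fun γ : Finset (Fin (n + 1)) => (loopNumber E γ : ℝ) with hzBdef
  have hD2 : 0 ≤ D / 2 := by positivity
  have h00 : ¬ IsMassMomentumSpanning E p m ∅ := not_isMassMomentumSpanning_empty_of_ne_zero hcons hΦ
  have h0A : zA ∅ = 0 := by simp [hzAdef, zSecondSymanzik_empty h00]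
  have h0B : zB ∅ = 0 := by simp [hzBdef, loopNumber_empty]
  have hzA : Supermodular zA :=
    supermodular_add (supermodular_sum_weights ν) (supermodular_smul (supermodular_zSecondSymanzik p m) hc)
  have hzB : Supermodular zB :=
    supermodular_add (supermodular_smul (supermodular_loopNumber E) hD2) (supermodular_smul (supermodular_loopNumber E) hc)
  have hr_eq : ∀ A : Finset (Fin (n + 1)),
      zA A - zB A = graphSdc E D ν A + c * (if IsMassMomentumSpanning E p m A then 1 else 0) := fun A =>
    scriptA_sub_scriptB_apply_of_neg D c ν A
  have hA : (∑ i : Option (Fin (n + 1)), (i.elim c ν) •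
      NP⟦(i.elim (secondSymanzikPolynomial E p m) (fun e => X e) : MvPolynomial (Fin (n + 1)) ℝ)⟧) = gpPolytope zA := by
    rw [Fintype.sum_option]
    simp only [Option.elim]
    exact (add_comm _ _).trans (scriptA_eq_gpPolytope_of_neg hconn hcons hgen hΦ ν hc)
  have hB : (∑ j : Fin 2, (![D / 2, c] j) •
      NP⟦(![kirchhoffPolynomial ℝ E, kirchhoffPolynomial ℝ E] j : MvPolynomial (Fin (n + 1)) ℝ)⟧) = gpPolytope zB := by
    rw [Fin.sum_univ_two]
    simp only [Matrix.cons_val_zero, Matrix.cons_val_one]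
    exact scriptB_eq_gpPolytope_of_neg hconn hD hc
  have hr' : ∀ A : Finset (Fin (n + 1)), A.Nonempty → A ≠ univ → zB A < zA A := fun A hA hA' =>
    sub_pos.1 ((hr_eq A).symm ▸ hr A hA hA')
  have htop : zA univ = zB univ := by
    refine sub_eq_zero.1 ?_
    rw [hr_eq univ, hωG, if_pos (isMassMomentumSpanning_univ hconn p m)]
    ring
  have key := Borinsky2020.integrable_of_gp_of_supermodular
    (fun i : Option (Fin (n + 1)) =>
      (i.elim (secondSymanzikPolynomial E p m) (fun e => X e) : MvPolynomial (Fin (n + 1)) ℝ))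
    ![kirchhoffPolynomial ℝ E, kirchhoffPolynomial ℝ E] (fun i => i.elim c ν) ![D / 2, c]
    (fun i => by cases i with
      | none => exact hΦ
      | some e => exact X_ne_zero e)
    (fun i => by cases i with
      | none => exact hc
      | some e => exact hν e)
    (fun j => by fin_cases j
                 · exact hD2
                 · exact hc)
    (db := ![loopNumber E univ, loopNumber E univ])
    (fun j => by fin_cases j <;> exact isHomogeneous_kirchhoffPolynomial E hconn)
    hzA h0A hzB h0B hA hB hr' htop
    (fun j => by fin_cases j <;> exact completelyNonVanishing_kirchhoffPolynomial E hconn)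
  refine key.congr (Filter.Eventually.of_forall fun y => ?_)
  simp only [Fintype.prod_option, Option.elim, eval_X, Fin.prod_univ_two, Matrix.cons_val_zero, Matrix.cons_val_one,
    abs_of_pos (exp_pos _)]
  ring

/-- **`ω(G) = 0`** ("For `ω(G)=0` this normalization factor is … the *Hepp-bound*"): for a connected edge list with `D ≥ 0`,
`ν_e ≥ 0`, `Σ_e ν_e − (D/2)ℓ(G) = 0` and `ω(γ) = Σ_{e∈γ} ν_e − (D/2)ℓ(γ) > 0` on every non-empty proper `γ`, the integrand
`Π_e x_e^{ν_e}/Ψ_G^{D/2}` (= (7.1) with `ω(G) = 0`; no kinematic data enter) is absolutely integrable over the chart —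
`𝒜 = Σ_e ν_e NP_{p_e} = 𝒢_{z_ν}`, `ℬ = ½D NP_Ψ = 𝒢_{(D/2)ℓ}` (companion `KirchhoffPermutahedron.lean`), R1 automatic.
[cite: Borinsky2020, §7.2 (tropical.tex l.1243–1247), Theorem 27 (l.1063–1072); Schultka2018, Proposition 2.47] -/
theorem integrable_kirchhoff {n V : ℕ} (E : Fin (n + 1) → Fin (V + 1) × Fin (V + 1)) (hconn : IsConnectedEdgeList E)
    {D : ℝ} (hD : 0 ≤ D) {ν : Fin (n + 1) → ℝ} (hν : ∀ e, 0 ≤ ν e) (hωG : graphSdc E D ν univ = 0)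
    (hr : ∀ γ : Finset (Fin (n + 1)), γ.Nonempty → γ ≠ univ → 0 < graphSdc E D ν γ) :
    Integrable (fun y : Fin n → ℝ =>
      (∏ e, exp (Fin.snoc (α := fun _ => ℝ) y 0 e) ^ ν e) /
        |eval (fun k => exp (Fin.snoc (α := fun _ => ℝ) y 0 k)) (kirchhoffPolynomial ℝ E)| ^ (D / 2)) := by
  set zA : Finset (Fin (n + 1)) → ℝ := fun γ => ∑ e ∈ γ, ν e with hzAdef
  set zB : Finset (Fin (n + 1)) → ℝ := (D / 2) • fun γ : Finset (Fin (n + 1)) => (loopNumber E γ : ℝ) with hzBdef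
  have hD2 : 0 ≤ D / 2 := by positivity
  have h0A : zA ∅ = 0 := by simp [hzAdef]
  have h0B : zB ∅ = 0 := by simp [hzBdef, loopNumber_empty]
  have hzA : Supermodular zA := supermodular_sum_weights ν
  have hzB : Supermodular zB := supermodular_smul (supermodular_loopNumber E) hD2
  have hr_eq : ∀ A : Finset (Fin (n + 1)), zA A - zB A = graphSdc E D ν A := fun A => by
    rw [graphSdc_eq_weights_sub_smul_loopNumber]
  have hA : (∑ e, ν e • NP⟦(X e : MvPolynomial (Fin (n + 1)) ℝ)⟧) = gpPolytope zA :=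
    sum_smul_newtonPolytope_X_eq_gpPolytope ν
  have hB : (∑ j : Fin 1, (![D / 2] j) • NP⟦(![kirchhoffPolynomial ℝ E] j : MvPolynomial (Fin (n + 1)) ℝ)⟧) =
      gpPolytope zB := by
    rw [Fin.sum_univ_one]
    simp only [Matrix.cons_val_fin_one]
    exact smul_newtonPolytope_kirchhoffPolynomial_eq_gpPolytope E hconn hD2
  have hr' : ∀ A : Finset (Fin (n + 1)), A.Nonempty → A ≠ univ → zB A < zA A := fun A hA hA' =>
    sub_pos.1 ((hr_eq A).symm ▸ hr A hA hA')
  have htop : zA univ = zB univ := sub_eq_zero.1 ((hr_eq univ).trans hωG)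
  have key := Borinsky2020.integrable_of_gp_of_supermodular
    (fun e : Fin (n + 1) => (X e : MvPolynomial (Fin (n + 1)) ℝ)) ![kirchhoffPolynomial ℝ E] ν ![D / 2]
    (fun e => X_ne_zero e) hν (fun j => by fin_cases j; exact hD2)
    (db := ![loopNumber E univ]) (fun j => by fin_cases j; exact isHomogeneous_kirchhoffPolynomial E hconn)
    hzA h0A hzB h0B hA hB hr' htop (fun j => by fin_cases j; exact completelyNonVanishing_kirchhoffPolynomial E hconn)
  refine key.congr (Filter.Eventually.of_forall fun y => ?_)
  simp only [eval_X, Fin.prod_univ_one, Matrix.cons_val_fin_one, abs_of_pos (exp_pos _)]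

end ConvergenceR1

end Literature.MathematicalPhysics.QuantumFieldTheory
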